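import Summits.CriticalPhenomena.Ising3DConformalLimit.Theses.EnergyNotSigmaSquared
import Literature.Probability.LatticeModels.CriticalScalingDimension
import Literature.Probability.LatticeModels.HighDimPointwiseTriviality
import Literature.Probability.LatticeModels.CriticalTwoPointDCPLowerHolds

/-!
# `MoebiusLimit` (item stmt-CriticalPhenomena-1344) forces `η` to exist: `η = 2Δ − 1`, so `Δ ∈ [1/2, 3/4]`

Negative knowledge about the crux `…Theses.EnergyNotSigmaSquared.MoebiusLimit`
(= `PerfectScreening.MoebiusLimitExists`, the conjunct `CritIsing3DConformalLimit` minus (iii)),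
standing crux disprover (D-0016); THEOREM-ONLY. `hasIsingExponentEta_of_covariantLimit`: an
`O(3)`-invariant, scale-covariant (dimension `Δ`), non-degenerate pointwise scaling limit of the
critical correlators on `ℤ³` forces `log ⟨σ₀σ_x⟩_{β_c} / log ‖x‖ → −2Δ`, i.e.
`HasIsingExponentEta 3 (2Δ − 1)` — uniform convergence on the compact shell
`{(0, y) : 1 ≤ ‖y‖_∞ ≤ 2}` at the dyadic meshes `2^{-(k+1)}` reaches EVERY lattice point of the
dyadic shell `2^{k+1} ≤ ‖x‖_∞ < 2^{k+2}`, and `log ρ(2^{-(k+1)})² / k → 2Δ log 2` (tree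
`tendsto_log_rho_sq_div`). Consequences: `Δ ≤ 3/4` (Duminil-Copin–Panis 2025 Thm 1.5, tree
`dcp_isingEta_le_half_holds`), `Δ ∈ [1/2, 3/4]`, `MoebiusLimit → ∃ η ∈ [0,1/2], HasIsingExponentEta 3 η`,
and the strengthening of the crux with `3/4 < Δ` is REFUTED (bootstrap `Δ_σ ≈ 0.518` inside).
-/

noncomputable section

namespace Summit.CriticalPhenomena.Ising3DConformalLimit.MoebiusLimitExistsNegative

open Literature.Probability.LatticeModels Filter Set
open scoped Topology

/-! ### The two-point function of an `O(3)`-invariant scale-covariant family -/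

/-- For an `O(3)`-invariant, scale-covariant family, `S₂(0, y) = ‖y‖^{-2Δ} S₂(0, e₀)` for every
`y ≠ 0` (a reflection maps `e₀` to `y/‖y‖`; dilation by `‖y‖`).
[cite: FrancescoMathieuSenechal1997, §4.3.1 eq. (4.55)] -/
theorem two_point_radial {Δ : ℝ} {S : CorrFamily 3} (hrot : IsRotationInvariant S)
    (hsc : IsScaleCovariant Δ S) {y : EuclideanSpace ℝ (Fin 3)} (hy : y ≠ 0) :
    S 2 ![0, y] = ‖y‖ ^ (-(2:ℝ) * Δ) * S 2 ![0, EuclideanSpace.single 0 1] := by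
  set v : EuclideanSpace ℝ (Fin 3) := EuclideanSpace.single 0 1 with hv
  set t : ℝ := ‖y‖ with ht
  have htpos : 0 < t := norm_pos_iff.2 hy
  set u : EuclideanSpace ℝ (Fin 3) := t⁻¹ • y with hu
  have hvn : ‖v‖ = 1 := by simp [hv]
  have hun : ‖u‖ = 1 := by
    rw [hu, norm_smul, norm_inv, Real.norm_of_nonneg htpos.le, ← ht, inv_mul_cancel₀ htpos.ne']
  set R := (Submodule.span ℝ {v - u})ᗮ.reflection with hR
  have hRv : R v = u := Submodule.reflection_sub (by rw [hvn, hun])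
  have h1 := hrot 2 R ![0, t • v]
  have hcfg : (fun i => R ((![0, t • v] : Fin 2 → EuclideanSpace ℝ (Fin 3)) i)) = ![0, y] := by
    funext i
    fin_cases i
    · simp
    · simp only [Fin.mk_one, Matrix.cons_val_one, Matrix.cons_val_fin_one, map_smul, hRv, hu,
        smul_smul, mul_inv_cancel₀ htpos.ne', one_smul]
  rw [hcfg] at h1
  have h2 := hsc 2 t htpos ![0, v]
  have hcfg2 : (fun i => t • (![0, v] : Fin 2 → EuclideanSpace ℝ (Fin 3)) i) = ![0, t • v] := by
    funext i; fin_cases i <;> simp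
  rw [hcfg2] at h2
  rw [h1, h2]
  push_cast
  ring_nf

/-! ### The compact shell of configurations `(0, y)`, `1 ≤ ‖y‖_∞ ≤ 2` -/

/-- The Euclidean norm of a point of the shell `{∀ i, |yᵢ| ≤ 2} ∩ {∃ i, 1 ≤ |yᵢ|}` lies in `[1, 4]`.
[folklore] -/
theorem norm_mem_Icc_of_shell {y : EuclideanSpace ℝ (Fin 3)} (h2 : ∀ i, |y i| ≤ 2)
    (h1 : ∃ i, 1 ≤ |y i|) : 1 ≤ ‖y‖ ∧ ‖y‖ ≤ 4 := by
  constructor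
  · obtain ⟨i, hi⟩ := h1
    have := PiLp.norm_apply_le y i
    rw [Real.norm_eq_abs] at this
    linarith
  · rw [EuclideanSpace.norm_eq]
    have hs : ∑ i, ‖y i‖ ^ 2 ≤ 16 := by
      have hb : ∀ i, ‖y i‖ ^ 2 ≤ 4 := fun i => by
        rw [Real.norm_eq_abs]
        nlinarith [h2 i, abs_nonneg (y i)]
      rw [Fin.sum_univ_three]
      linarith [hb 0, hb 1, hb 2]
    calc √(∑ i, ‖y i‖ ^ 2) ≤ √16 := Real.sqrt_le_sqrt hs
      _ = 4 := by rw [show (16:ℝ) = 4 ^ 2 by norm_num, Real.sqrt_sq (by norm_num)]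

/-- The set of configurations `(0, y)` with `y` in the shell is compact. [folklore] -/
theorem isCompact_shell_configs :
    IsCompact ((fun y : EuclideanSpace ℝ (Fin 3) => (![0, y] : Fin 2 → EuclideanSpace ℝ (Fin 3))) ''
      {y | (∀ i, |y i| ≤ 2) ∧ ∃ i, 1 ≤ |y i|}) := by
  refine IsCompact.image ?_ ?_
  · apply Metric.isCompact_of_isClosed_isBounded
    · have hc : ∀ i : Fin 3, Continuous fun y : EuclideanSpace ℝ (Fin 3) => |y i| := by
        intro i; fun_prop
      have h1 : IsClosed {y : EuclideanSpace ℝ (Fin 3) | ∀ i, |y i| ≤ 2} := by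
        rw [Set.setOf_forall]
        exact isClosed_iInter fun i => isClosed_le (hc i) continuous_const
      have h2 : IsClosed {y : EuclideanSpace ℝ (Fin 3) | ∃ i, 1 ≤ |y i|} := by
        rw [Set.setOf_exists]
        exact isClosed_iUnion_of_finite fun i => isClosed_le continuous_const (hc i)
      rw [Set.setOf_and]
      exact h1.inter h2
    · rw [Metric.isBounded_iff_subset_closedBall 0]
      refine ⟨4, fun y hy => ?_⟩
      rw [Metric.mem_closedBall, dist_zero_right]
      exact (norm_mem_Icc_of_shell hy.1 hy.2).2
  · refine continuous_pi fun i => ?_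
    fin_cases i
    · simpa using continuous_const
    · exact (continuous_id : Continuous fun y : EuclideanSpace ℝ (Fin 3) => y)

/-- For a lattice point `x` with `2^{k+1} ≤ ‖x‖_∞ < 2^{k+2}`, the rescaled point `δ_k x`,
`δ_k = 2^{-(k+1)}`, lies in the shell. [folklore] -/
theorem smul_siteVec_mem_shell {k : ℕ} {x : Site 3} (hlo : 2 ^ (k + 1) ≤ Site.supNorm x)
    (hhi : Site.supNorm x < 2 ^ (k + 2)) :
    (∀ i, |((2:ℝ)⁻¹ ^ (k + 1) • siteVec x) i| ≤ 2) ∧ ∃ i, 1 ≤ |((2:ℝ)⁻¹ ^ (k + 1) • siteVec x) i| := by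
  have hδ : (0:ℝ) < 2⁻¹ ^ (k + 1) := by positivity
  have hcoord : ∀ i, |((2:ℝ)⁻¹ ^ (k + 1) • siteVec x) i| = 2⁻¹ ^ (k + 1) * ((x i).natAbs : ℝ) := by
    intro i
    rw [PiLp.smul_apply, siteVec_apply, smul_eq_mul, abs_mul, abs_of_pos hδ, Nat.cast_natAbs,
      Int.cast_abs]
  have h2k : (2:ℝ)⁻¹ ^ (k + 1) * 2 ^ (k + 1) = 1 := by
    rw [← mul_pow, inv_mul_cancel₀ two_ne_zero, one_pow]
  constructor
  · intro i
    rw [hcoord i]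
    have hi : ((x i).natAbs : ℝ) ≤ Site.supNorm x := by exact_mod_cast Site.natAbs_le_supNorm x i
    have hs : (Site.supNorm x : ℝ) ≤ 2 ^ (k + 2) := by exact_mod_cast hhi.le
    calc (2:ℝ)⁻¹ ^ (k + 1) * ((x i).natAbs : ℝ) ≤ 2⁻¹ ^ (k + 1) * 2 ^ (k + 2) := by
          exact mul_le_mul_of_nonneg_left (hi.trans hs) hδ.le
      _ = 2 := by rw [pow_succ (2:ℝ) (k + 1), ← mul_assoc, h2k, one_mul]
  · have hne : (Finset.univ : Finset (Fin 3)).Nonempty := ⟨0, Finset.mem_univ _⟩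
    obtain ⟨i, hi⟩ := Site.exists_natAbs_eq_supNorm hne x
    refine ⟨i, ?_⟩
    rw [hcoord i, hi]
    have hs : (2:ℝ) ^ (k + 1) ≤ Site.supNorm x := by exact_mod_cast hlo
    calc (1:ℝ) = 2⁻¹ ^ (k + 1) * 2 ^ (k + 1) := h2k.symm
      _ ≤ 2⁻¹ ^ (k + 1) * Site.supNorm x := mul_le_mul_of_nonneg_left hs hδ.le

/-- At mesh `δ_k` the lattice approximation of `(0, δ_k x)` is `(0, x)` exactly, so the rescaled
pair correlator there is `ρ(δ_k)² ⟨σ₀σ_x⟩_{β_c}`. [folklore] -/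
theorem rescaledCorrelator_zero_smul_siteVec (ρ : ℝ → ℝ) (k : ℕ) (x : Site 3) :
    rescaledCorrelator (criticalCorr 3) ρ 2 ((2:ℝ)⁻¹ ^ (k + 1)) ![0, (2:ℝ)⁻¹ ^ (k + 1) • siteVec x] =
      ρ ((2:ℝ)⁻¹ ^ (k + 1)) ^ 2 * criticalTwoPoint 3 x := by
  have hδ : (0:ℝ) < 2⁻¹ ^ (k + 1) := by positivity
  rw [rescaledCorrelator_apply, ← criticalCorr_two]
  congr 2
  funext i
  fin_cases i
  · simp [latticeApprox_zero]
  · simpa using latticeApprox_smul_siteVec hδ x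

/-! ### The main theorem -/

/-- **An `O(3)`-invariant, scale-covariant, non-degenerate pointwise scaling limit of the
critical correlators on `ℤ³` forces the anomalous dimension to exist, `η = 2Δ − 1`:**
`log ⟨σ₀σ_x⟩_{β_c} / log ‖x‖_∞ → −2Δ` as `x → ∞` in `ℤ³`. In particular every witness of the crux
`MoebiusLimit` yields `HasIsingExponentEta 3 (2Δ − 1)` (translation and inversion covariance are
not used). [cite: FrancescoMathieuSenechal1997, §4.3.1 eq. (4.56)] -/
theorem hasIsingExponentEta_of_covariantLimit {ρ : ℝ → ℝ} {Δ : ℝ} {S : CorrFamily 3}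
    (hρ : ∀ δ ∈ Set.Ioc (0:ℝ) 1, 0 < ρ δ) (hlim : HasPointwiseScalingLimit (criticalCorr 3) ρ S)
    (hnd : IsNondegenerateTwoPoint S) (hrot : IsRotationInvariant S) (hsc : IsScaleCovariant Δ S) :
    HasIsingExponentEta 3 (2 * Δ - 1) := by
  -- constants
  set A₀ : ℝ := S 2 ![0, EuclideanSpace.single 0 1] with hA₀def
  have hA₀ : 0 < A₀ := hnd _ (zero_unitVec_mem_nonCoincident one_ne_zero)
  have hΔ : 1 / 2 ≤ Δ := (scalingDimension_mem_Icc_holds ρ Δ S hlim hsc hnd hρ).1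
  have hexp : -(2:ℝ) * Δ ≤ 0 := by linarith
  set m : ℝ := (4:ℝ) ^ (-(2:ℝ) * Δ) * A₀ with hmdef
  have hm : 0 < m := mul_pos (Real.rpow_pos_of_pos (by norm_num) _) hA₀
  -- the shell and its configurations
  set T : Set (EuclideanSpace ℝ (Fin 3)) := {y | (∀ i, |y i| ≤ 2) ∧ ∃ i, 1 ≤ |y i|} with hTdef
  set K : Set (Fin 2 → EuclideanSpace ℝ (Fin 3)) :=
    (fun y : EuclideanSpace ℝ (Fin 3) => (![0, y] : Fin 2 → EuclideanSpace ℝ (Fin 3))) '' T with hKdef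
  have hKc : IsCompact K := isCompact_shell_configs
  have hTne : ∀ y ∈ T, y ≠ 0 := by
    intro y hy h0
    have := (norm_mem_Icc_of_shell hy.1 hy.2).1
    rw [h0, norm_zero] at this
    linarith
  have hKs : K ⊆ NonCoincident 3 2 := by
    rintro _ ⟨y, hy, rfl⟩
    exact pair_mem_nonCoincident (Ne.symm (hTne y hy))
  have hSK : ∀ y ∈ T, m ≤ S 2 ![0, y] ∧ S 2 ![0, y] ≤ A₀ := by
    intro y hy
    obtain ⟨hn1, hn4⟩ := norm_mem_Icc_of_shell hy.1 hy.2
    have hnpos : 0 < ‖y‖ := by linarith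
    rw [two_point_radial hrot hsc (hTne y hy)]
    constructor
    · exact mul_le_mul_of_nonneg_right (Real.rpow_le_rpow_of_nonpos hnpos hn4 hexp) hA₀.le
    · have h1 : ‖y‖ ^ (-(2:ℝ) * Δ) ≤ 1 := by
        have := Real.rpow_le_rpow_of_nonpos one_pos hn1 hexp
        rwa [Real.one_rpow] at this
      calc ‖y‖ ^ (-(2:ℝ) * Δ) * A₀ ≤ 1 * A₀ := mul_le_mul_of_nonneg_right h1 hA₀.le
        _ = A₀ := one_mul _
  -- uniform convergence on K within m/2
  have hU : TendstoUniformlyOn (rescaledCorrelator (criticalCorr 3) ρ 2) (S 2) (𝓝[>] 0) K :=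
    (tendstoLocallyUniformlyOn_iff_forall_isCompact (isOpen_nonCoincident 3 2)).1 (hlim 2) K hKs hKc
  have hev : ∀ᶠ δ in 𝓝[>] (0:ℝ), ∀ y ∈ T,
      m / 2 < rescaledCorrelator (criticalCorr 3) ρ 2 δ ![0, y] ∧
        rescaledCorrelator (criticalCorr 3) ρ 2 δ ![0, y] < A₀ + m / 2 := by
    filter_upwards [Metric.tendstoUniformlyOn_iff.1 hU (m / 2) (half_pos hm)] with δ hδ y hy
    have h := hδ _ ⟨y, hy, rfl⟩
    rw [Real.dist_eq] at h
    have h' := abs_sub_lt_iff.1 h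
    obtain ⟨hl, hu⟩ := hSK y hy
    constructor <;> linarith [h'.1, h'.2]
  -- along the dyadic meshes: bounds for ALL lattice points of the k-th dyadic shell
  have hevk : ∀ᶠ k : ℕ in atTop, ∀ x : Site 3, 2 ^ (k + 1) ≤ Site.supNorm x →
      Site.supNorm x < 2 ^ (k + 2) →
        m / 2 < ρ ((2:ℝ)⁻¹ ^ (k + 1)) ^ 2 * criticalTwoPoint 3 x ∧
          ρ ((2:ℝ)⁻¹ ^ (k + 1)) ^ 2 * criticalTwoPoint 3 x < A₀ + m / 2 := by
    filter_upwards [tendsto_dyadicMesh.eventually hev] with k hk x hlo hhi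
    have h := hk _ (smul_siteVec_mem_shell hlo hhi)
    rwa [rescaledCorrelator_zero_smul_siteVec] at h
  -- the renormalisation: `log ρ(δ_k)² / k → 2Δ log 2`
  have hrho := tendsto_log_rho_sq_div hlim hsc hnd hρ
  -- ε-management
  have hl2 : 0 < Real.log 2 := Real.log_pos one_lt_two
  set L : ℝ := Real.log 2 with hLdef
  set c : ℝ := 2 * Δ * L with hcdef
  set Θ : ℝ := max |Real.log (m / 2)| |Real.log (A₀ + m / 2)| with hΘdef
  have hΔpos : 0 < Δ := by linarith
  unfold HasIsingExponentEta HasSpatialDecayExponent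
  have htarget : (-(((3:ℕ):ℝ) - 2 + (2 * Δ - 1))) = -(2 * Δ) := by push_cast; ring
  rw [htarget, Metric.tendsto_nhds]
  intro ε hε
  -- choose k₁
  have hε' : 0 < ε * L / 2 := by positivity
  have hrho' : ∀ᶠ k : ℕ in atTop,
      |Real.log (ρ ((2:ℝ)⁻¹ ^ (k + 1)) ^ 2) / k - c| < ε * L / 2 := by
    have := (Metric.tendsto_nhds.1 hrho) _ hε'
    simpa only [Real.dist_eq] using this
  have htail : ∀ᶠ k : ℕ in atTop, (Θ + 4 * Δ * L) / ((k + 1) * L) < ε / 2 := by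
    have ht : Tendsto (fun k : ℕ => (Θ + 4 * Δ * L) / ((k + 1) * L)) atTop (𝓝 0) := by
      have h1 : Tendsto (fun k : ℕ => ((k:ℝ) + 1) * L) atTop atTop :=
        (tendsto_natCast_atTop_atTop.atTop_add tendsto_const_nhds).atTop_mul_const hl2
      exact tendsto_const_nhds.div_atTop h1
    filter_upwards [(Metric.tendsto_nhds.1 ht) _ (half_pos hε)] with k hk
    rw [Real.dist_eq, sub_zero] at hk
    exact lt_of_abs_lt hk
  obtain ⟨k₁, hk₁⟩ := eventually_atTop.1 (hevk.and (hrho'.and (htail.and (eventually_ge_atTop 1))))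
  -- the exceptional set is contained in a finite box
  have hfin : {x : Site 3 | Site.supNorm x < 2 ^ (k₁ + 1)}.Finite := by
    refine (box 3 (2 ^ (k₁ + 1))).finite_toSet.subset fun x hx => ?_
    rw [Finset.mem_coe, mem_box_iff_supNorm_le]
    exact le_of_lt hx
  rw [Filter.eventually_cofinite]
  refine hfin.subset fun x hx => ?_
  -- contrapositive: for `‖x‖_∞ ≥ 2^{k₁+1}` the estimate holds
  rw [Set.mem_setOf_eq] at hx ⊢
  by_contra hge
  push Not at hge
  apply hx
  -- the dyadic scale of x
  set N := Site.supNorm x with hNdef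
  have hNpos : 0 < N := lt_of_lt_of_le (by positivity) hge
  set k : ℕ := Nat.log 2 N - 1 with hkdef
  have hlogN : k₁ + 1 ≤ Nat.log 2 N := Nat.le_log_of_pow_le one_lt_two hge
  have hk1 : k + 1 = Nat.log 2 N := by omega
  have hkk₁ : k₁ ≤ k := by omega
  have hlo : 2 ^ (k + 1) ≤ N := by rw [hk1]; exact Nat.pow_log_le_self 2 hNpos.ne'
  have hhi : N < 2 ^ (k + 2) := by
    rw [show k + 2 = (Nat.log 2 N).succ by omega]
    exact Nat.lt_pow_succ_log_self one_lt_two N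
  obtain ⟨hkx, hkρ, hkt, hk1'⟩ := hk₁ k hkk₁
  obtain ⟨hGlo, hGhi⟩ := hkx x hlo hhi
  -- notation
  set r : ℝ := ρ ((2:ℝ)⁻¹ ^ (k + 1)) ^ 2 with hrdef
  set g : ℝ := criticalTwoPoint 3 x with hgdef
  have hrpos : 0 < r := pow_pos (hρ _ ⟨dyadicMesh_pos k, dyadicMesh_le_one k⟩) 2
  have hgpos : 0 < g := by
    by_contra h
    push Not at h
    have : r * g ≤ 0 := mul_nonpos_of_nonneg_of_nonpos hrpos.le h
    linarith [half_pos hm]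
  -- logs
  have hθ : |Real.log (r * g)| ≤ Θ := by
    have h1 : Real.log (m / 2) < Real.log (r * g) := Real.log_lt_log (half_pos hm) hGlo
    have h2 : Real.log (r * g) < Real.log (A₀ + m / 2) := Real.log_lt_log (by positivity) hGhi
    rw [abs_le]
    have := neg_abs_le (Real.log (m / 2))
    have := le_max_left |Real.log (m / 2)| |Real.log (A₀ + m / 2)|
    have := le_abs_self (Real.log (A₀ + m / 2))
    have := le_max_right |Real.log (m / 2)| |Real.log (A₀ + m / 2)|
    constructor <;> linarith
  have hlogg : Real.log g = Real.log (r * g) - Real.log r := by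
    rw [Real.log_mul hrpos.ne' hgpos.ne']; ring
  -- the norm of x and its logarithm ℓ
  set ℓ : ℝ := Real.log ‖x‖ with hℓdef
  set kk : ℝ := (k : ℝ) with hkkdef
  have hnorm : ‖x‖ = (N : ℝ) := Site.norm_eq_supNorm x
  have hNreal : (2:ℝ) ^ (k + 1) ≤ N := by exact_mod_cast hlo
  have hNreal' : (N : ℝ) ≤ 2 ^ (k + 2) := by exact_mod_cast hhi.le
  have hNpos' : (0:ℝ) < N := by exact_mod_cast hNpos
  have hℓlo : kk * L + L ≤ ℓ := by
    have h := Real.log_le_log (by positivity) hNreal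
    rw [Real.log_pow] at h; push_cast at h; rw [hℓdef, hnorm]; linarith
  have hℓhi : ℓ ≤ kk * L + 2 * L := by
    have h := Real.log_le_log hNpos' hNreal'
    rw [Real.log_pow] at h; push_cast at h; rw [hℓdef, hnorm]; linarith
  have hℓpos : 0 < ℓ := by
    have : 0 ≤ kk * L := by positivity
    linarith
  have hkpos : (0:ℝ) < kk := by rw [hkkdef]; exact_mod_cast hk1'
  -- (A) the renormalisation term
  have hA : |c * kk - Real.log r| ≤ ε / 2 * (kk * L) := by
    have e : (Real.log r / kk - c) * kk = Real.log r - c * kk := by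
      rw [sub_mul, div_mul_cancel₀ _ hkpos.ne']
    calc |c * kk - Real.log r| = |(Real.log r / kk - c) * kk| := by rw [e, abs_sub_comm]
      _ = |Real.log r / kk - c| * kk := by rw [abs_mul, abs_of_pos hkpos]
      _ ≤ (ε * L / 2) * kk := mul_le_mul_of_nonneg_right hkρ.le hkpos.le
      _ = ε / 2 * (kk * L) := by ring
  -- (B) the scale-bracket term
  have hd0 : 0 ≤ ℓ - kk * L := by linarith
  have hd2 : ℓ - kk * L ≤ 2 * L := by linarith
  have hB : |2 * Δ * (ℓ - kk * L)| ≤ 4 * Δ * L := by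
    rw [abs_of_nonneg (mul_nonneg (by positivity) hd0)]
    calc 2 * Δ * (ℓ - kk * L) ≤ 2 * Δ * (2 * L) := mul_le_mul_of_nonneg_left hd2 (by positivity)
      _ = 4 * Δ * L := by ring
  -- assemble
  rw [Real.dist_eq]
  have hkey : Real.log g / ℓ - -(2 * Δ) =
      ((c * kk - Real.log r) + Real.log (r * g) + 2 * Δ * (ℓ - kk * L)) / ℓ := by
    rw [eq_div_iff hℓpos.ne', hlogg, hcdef]
    field_simp
    ring
  rw [hkey, abs_div, abs_of_pos hℓpos, div_lt_iff₀ hℓpos]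
  have htri := abs_add_three (c * kk - Real.log r) (Real.log (r * g)) (2 * Δ * (ℓ - kk * L))
  have htail' : Θ + 4 * Δ * L < ε / 2 * ((kk + 1) * L) := by
    have hden : (0:ℝ) < (kk + 1) * L := by positivity
    have := hkt
    rwa [div_lt_iff₀ hden] at this
  have hkl : kk * L ≤ ℓ := by
    have : 0 ≤ L := hl2.le
    linarith
  have hkl' : (kk + 1) * L ≤ ℓ := by linarith
  have step1 : |c * kk - Real.log r| + |Real.log (r * g)| + |2 * Δ * (ℓ - kk * L)| ≤
      ε / 2 * (kk * L) + Θ + 4 * Δ * L := add_le_add (add_le_add hA hθ) hB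
  have step2 : ε / 2 * (kk * L) + Θ + 4 * Δ * L < ε / 2 * (kk * L) + ε / 2 * ((kk + 1) * L) := by
    linarith
  have step3 : ε / 2 * (kk * L) + ε / 2 * ((kk + 1) * L) ≤ ε / 2 * ℓ + ε / 2 * ℓ :=
    add_le_add (mul_le_mul_of_nonneg_left hkl (by positivity))
      (mul_le_mul_of_nonneg_left hkl' (by positivity))
  have step4 : ε / 2 * ℓ + ε / 2 * ℓ = ε * ℓ := by ring
  exact (htri.trans step1).trans_lt ((step2.trans_le step3).trans_eq step4)

/-- **Every such limit has `Δ ≤ 3/4`** (`η = 2Δ − 1 ≤ 1/2`, Duminil-Copin–Panis 2025 Thm 1.5,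
tree theorem `dcp_isingEta_le_half_holds`). [cite: DuminilCopinPanis2025LowerBounds, Theorem 1.5] -/
theorem delta_le_three_quarters_of_covariantLimit {ρ : ℝ → ℝ} {Δ : ℝ} {S : CorrFamily 3}
    (hρ : ∀ δ ∈ Set.Ioc (0:ℝ) 1, 0 < ρ δ) (hlim : HasPointwiseScalingLimit (criticalCorr 3) ρ S)
    (hnd : IsNondegenerateTwoPoint S) (hrot : IsRotationInvariant S) (hsc : IsScaleCovariant Δ S) :
    Δ ≤ 3 / 4 := by
  have h := dcp_isingEta_le_half_holds _ (hasIsingExponentEta_of_covariantLimit hρ hlim hnd hrot hsc)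
  linarith

/-- **The forced window `Δ ∈ [1/2, 3/4]`** for any `O(3)`-invariant scale-covariant
non-degenerate pointwise limit of the critical correlators on `ℤ³` (infrared bound below,
DCP25 Thm 1.5 above). [cite: DuminilCopinPanis2025LowerBounds, Theorem 1.5] -/
theorem delta_mem_Icc_of_covariantLimit {ρ : ℝ → ℝ} {Δ : ℝ} {S : CorrFamily 3}
    (hρ : ∀ δ ∈ Set.Ioc (0:ℝ) 1, 0 < ρ δ) (hlim : HasPointwiseScalingLimit (criticalCorr 3) ρ S)
    (hnd : IsNondegenerateTwoPoint S) (hrot : IsRotationInvariant S) (hsc : IsScaleCovariant Δ S) :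
    Δ ∈ Set.Icc (1 / 2 : ℝ) (3 / 4) :=
  ⟨(scalingDimension_mem_Icc_holds ρ Δ S hlim hsc hnd hρ).1,
    delta_le_three_quarters_of_covariantLimit hρ hlim hnd hrot hsc⟩

/-- **The crux implies the existence of `η` on `ℤ³`** (an open statement on its own,
cf. item stmt-CriticalPhenomena-0635): `MoebiusLimit → ∃ η ∈ [0, 1/2], HasIsingExponentEta 3 η`.
[cite: DuminilCopinPanis2025LowerBounds, Theorem 1.5] -/
theorem moebiusLimit_implies_eta_exists
    (h : Summit.CriticalPhenomena.Ising3DConformalLimit.Theses.EnergyNotSigmaSquared.MoebiusLimit) :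
    ∃ η : ℝ, η ∈ Set.Icc (0:ℝ) (1 / 2) ∧ HasIsingExponentEta 3 η := by
  obtain ⟨ρ, Δ, S, hρ, -, hlim, hnd, hM⟩ := h
  have hw := delta_mem_Icc_of_covariantLimit hρ hlim hnd hM.isEuclideanInvariant.2 hM.isScaleCovariant
  exact ⟨2 * Δ - 1, ⟨by linarith [hw.1], by linarith [hw.2]⟩,
    hasIsingExponentEta_of_covariantLimit hρ hlim hnd hM.isEuclideanInvariant.2 hM.isScaleCovariant⟩

/-- REFUTED STRENGTHENING of the crux: no witness has `3/4 < Δ`.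
[cite: DuminilCopinPanis2025LowerBounds, Theorem 1.5] -/
theorem not_moebiusLimit_with_delta_gt_three_quarters :
    ¬ ∃ (ρ : ℝ → ℝ) (Δ : ℝ) (S : CorrFamily 3), (∀ δ ∈ Set.Ioc (0:ℝ) 1, 0 < ρ δ) ∧ 0 < Δ ∧
      HasPointwiseScalingLimit (criticalCorr 3) ρ S ∧ IsNondegenerateTwoPoint S ∧
        IsMoebiusCovariant Δ S ∧ 3 / 4 < Δ := by
  rintro ⟨ρ, Δ, S, hρ, -, hlim, hnd, hM, hΔ⟩
  have := delta_le_three_quarters_of_covariantLimit hρ hlim hnd hM.isEuclideanInvariant.2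
    hM.isScaleCovariant
  linarith

/-- The Euclidean statement `CritIsing3DEuclideanLimit` (item 0638-type) already forces
`Δ ∈ [1/2, 3/4]` and the existence of `η`. [cite: DuminilCopinPanis2025LowerBounds, Theorem 1.5] -/
theorem euclideanLimit_implies_eta_exists (h : CritIsing3DEuclideanLimit) :
    ∃ (Δ η : ℝ), Δ ∈ Set.Icc (1 / 2 : ℝ) (3 / 4) ∧ η = 2 * Δ - 1 ∧ HasIsingExponentEta 3 η := by
  obtain ⟨ρ, Δ, S, hρ, -, hlim, hnd, hE, hsc⟩ := h
  exact ⟨Δ, 2 * Δ - 1, delta_mem_Icc_of_covariantLimit hρ hlim hnd hE.2 hsc, rfl,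
    hasIsingExponentEta_of_covariantLimit hρ hlim hnd hE.2 hsc⟩

end Summit.CriticalPhenomena.Ising3DConformalLimit.MoebiusLimitExistsNegative

end
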